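import Mathlib
import Literature.MathematicalPhysics.MHD.HainLustSigmaStability
import Summits.Ventures.FusionMHD.Models.KinkEqScrewPinchQ07Witness
import HarnessLib

/-!
# F3.σ ★ #95 precision token «#95-RAYLEIGH»: the CERTIFIED Rayleigh clause of the kink witness — `−W/I > σ² = 10⁻⁴` for the
# displacement `(ξ, η_*, ζ_*)` of `Models/KinkEqScrewPinchQ07Witness.lean` (MODEL M_kink, mode `(1,1)`, `σ = 1/100`)

LADDER-GRIDFUSION rung F3 (lead g7 RULING 8s (3): ★★ precision token on ★ #95 «F3.σ-KINK-UNSTABLE», LOW, no count; seat `gridfusion-sos-6`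
g5, 2026-08-27).  Two exact steps on top of the tree: lit-4's `ScrewPinch.DynProfile.kineticNorm_pos_of_ne` (HainLustSigmaStability §10″,
p541090: `I > 0` for a displacement whose radial part is continuous and not identically zero on `(0, a)`, given integrability of the norm
density) and `sq_lt_rayleigh_of_sigmaModifiedEnergy_neg` (`W + σ²I < 0 ∧ I > 0 ⇒ σ² < −W/I`), applied to `KinkEqQ07.kink_sigma_unstable`
with the #95 file's own `xiK_contDiff`, `kineticDensity_integrableK` and `ξ(1/2) ≠ 0`.  What it upgrades: in ★ #95's sentence the clause
«the witness's Rayleigh quotient −W/I exceeds 10⁻⁴» moves from VALIDATED (lit-4 / sos-2 quadrature −1.12·10⁻⁴ / 0.429 ≈ 2.6·10⁻⁴) to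
CERTIFIED as the INEQUALITY `−W/I > 10⁻⁴` (the VALUE ≈ 2.6·10⁻⁴ stays VALIDATED).  MODELLED reading unchanged (GoedbloedPoedts2004 (6.117):
for an eigenmode `W = ω²I`, so `−W/I` is the squared growth rate of the Rayleigh–Ritz reading — here a WITNESS, not an eigenmode); never
«the plasma is unstable»; not about any device.  No `native_decide`, no `sorry`.  [instance data]
-/

noncomputable section

open Set Literature.MathematicalPhysics.MHD

namespace Summit.Ventures.FusionMHD.Models.KinkEqQ07

/-- `ξ(1/2) ≠ 0`. [instance data] -/
theorem xiK_half_ne : xiK (1 / 2) ≠ 0 := by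
  simp only [xiK, XIP_eval]
  norm_num

/-- **`I > 0`** for the witness displacement `(ξ, η_*, ζ_*)` (ρ ≡ 1; `ξ` continuous and `ξ(1/2) ≠ 0`; the norm density is integrable by
`kineticDensity_integrableK`). [instance data] -/
theorem kink_kineticNorm_pos :
    0 < hlK.kineticNorm 1 xiK (hlK.etaStarOf 1 (-1 / 5) (1 / 100) xiK) (hlK.zetaStarOf 1 (-1 / 5) (1 / 100) xiK) :=
  ScrewPinch.DynProfile.kineticNorm_pos_of_ne (P := hlK) one_pos (fun r _ => by show (0 : ℝ) < 1; norm_num)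
    kineticDensity_integrableK xiK_contDiff.continuous.continuousOn ⟨1 / 2, ⟨by norm_num, by norm_num⟩, xiK_half_ne⟩

/-- **«#95-RAYLEIGH»** (CERTIFIED, MODEL M_kink, the #95 witness): `σ² = 10⁻⁴ < −W/I` — the Rayleigh quotient of the explicit displacement
`(ξ, η_*, ζ_*)` is below `−10⁻⁴` (`W/I < −σ²`).  In the MODELLED spectral reading a growth-rate reading of at least `0.01 v_A/a`; the number
`−W/I ≈ 2.6·10⁻⁴` itself stays VALIDATED.  Never «the plasma is unstable»; not about any device. [instance data] -/
theorem kink_rayleigh :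
    (1 / 100 : ℝ) ^ 2 < -hlK.potentialEnergy 1 (-1 / 5) 1 xiK (hlK.etaStarOf 1 (-1 / 5) (1 / 100) xiK) (hlK.zetaStarOf 1 (-1 / 5) (1 / 100) xiK)
      / hlK.kineticNorm 1 xiK (hlK.etaStarOf 1 (-1 / 5) (1 / 100) xiK) (hlK.zetaStarOf 1 (-1 / 5) (1 / 100) xiK) :=
  ScrewPinch.DynProfile.sq_lt_rayleigh_of_sigmaModifiedEnergy_neg kink_sigma_unstable kink_kineticNorm_pos

/-- Equivalently `W < −σ²·I = −10⁻⁴·I` for the witness. [instance data] -/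
theorem kink_potentialEnergy_lt :
    hlK.potentialEnergy 1 (-1 / 5) 1 xiK (hlK.etaStarOf 1 (-1 / 5) (1 / 100) xiK) (hlK.zetaStarOf 1 (-1 / 5) (1 / 100) xiK)
      < -(1 / 100 : ℝ) ^ 2 * hlK.kineticNorm 1 xiK (hlK.etaStarOf 1 (-1 / 5) (1 / 100) xiK) (hlK.zetaStarOf 1 (-1 / 5) (1 / 100) xiK) :=
  ScrewPinch.DynProfile.potentialEnergy_lt_of_sigmaModifiedEnergy_neg kink_sigma_unstable

end Summit.Ventures.FusionMHD.Models.KinkEqQ07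

end
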